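import Mathlib.Analysis.SpecialFunctions.SmoothTransition
import Mathlib.Analysis.SpecialFunctions.Trigonometric.Deriv
import Mathlib.MeasureTheory.Measure.Haar.InnerProductSpace
import Mathlib.MeasureTheory.Measure.Lebesgue.EqHaar
import Mathlib.MeasureTheory.Integral.Bochner.Basic
import Literature.Analysis.FluidPDE.AxisymmetricEuler
import HarnessLib

/-!
# Integration of axially periodic functions against windows: the period-slab identity and a
# smooth partition-of-unity window

Analysis/FluidPDE infrastructure file (definitions with their API; everything proved, no named
facts). It supplies the bookkeeping by which estimates "per period" for functions on `ℝ³` that are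
periodic in the axial variable `z = x 2` (the tree's `IsAxiallyPeriodic P Q`:
`Q (x + P e_z) = Q x`) are obtained from whole-space identities with **compactly supported**
test functions — the device used by the periodic De Giorgi–Nash–Moser argument of
Z. Lei, X. Ren, Q. S. Zhang, *On ancient periodic solutions to axially-symmetric Navier–Stokes
equations*, arXiv:1902.11229 = Math. Ann. 383 (2022), §§2–3, where all integrals are taken over
one period `D_R = {r < R} × [0, Z₀)` with cut-off functions independent of `z` and "the integral
element is `dx ds`" on `D_R` (p. 5), boundary terms in `z` being absent by periodicity.

* `zSlab P k = {x | kP ≤ x 2 < (k+1)P}` — the period slabs; measurable, pairwise disjoint,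
  covering `ℝ³` (`P > 0`); `∫⁻_{zSlab P k} f = ∫⁻_{zSlab P 0} f(· + kP e_z)` (translation
  invariance of Lebesgue measure).
* **The period-slab identity** (`lintegral_mul_comp_apply_two_eq`): for `Q ≥ 0` a.e.-measurable
  and `P`-periodic in `z` and any measurable `W : ℝ → [0, ∞]`,
  `∫⁻ Q(x) W(x 2) dx = ∫⁻_{zSlab P 0} Q(x) · (∑_{k ∈ ℤ} W(x 2 + kP)) dx`.
  Consequences: if `∑ₖ W(z + kP) = c` for all `z` then `∫⁻ Q W(x 2) = c ∫⁻_{zSlab P 0} Q`;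
  the integral of `Q` over `m` consecutive slabs is `m ∫⁻_{zSlab P 0} Q`; Bochner versions for
  real `Q` integrable on one slab.
* `periodicWindow P` — a smooth function `ω : ℝ → [0, 1]` supported in `[0, 2P]` with
  `∑_{k ∈ ℤ} ω(z + kP)² = 1` for every `z` (`tsum_periodicWindow_sq`): explicitly
  `ω(z) = sin θ(z/P) · cos θ(z/P − 1)`, `θ = (π/2)·smoothTransition`, so that on `[0, P)` the two
  live translates are `sin θ` and `cos θ` of the same argument. Hence
  `∫ Q(x) ω(x 2)² dx = ∫_{zSlab P 0} Q` for periodic `Q` (`integral_mul_periodicWindow_sq`):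
  a whole-space integral against the compactly supported smooth weight `ω(z)²` **is** the
  integral over one period.

## Why (design)

The tree's energy identities for the swirl equation (`LeiZhang2011.energy_identity`) are proved on
`ℝ³` for `C²` cut-offs of compact support; with the cut-off `φ_R(r) ω(z)` they become identities
per period, and the terms in which a derivative falls on `ω` are integrals of periodic densities
against `(ω²)'`, which vanish (sequel file) because `∑ₖ (ω²)'(z + kP) = 0`. No quotient types
(`AddCircle`) and no product decompositions `ℝ³ = ℝ² × ℝ` are used: everything is the slab
decomposition plus translation invariance.

## Mathlib / tree search

Tree: `IsAxiallyPeriodic`, `eZ`, `cylRadius` (`AxisymmetricEuler`); the period-cell files of the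
Kato–Lai programme (`PeriodicCylinderCellTranslates`: `lintegral_axialTranslate_cylinderCell_eq`,
`PeriodicCylinderSymmetry`: `axialRed`) prove the analogous translation statements for the bounded
cell `{r < 1} × (0, L)` with heavy imports; this file is import-light and works on whole slabs.
Mathlib: `lintegral_iUnion`, `lintegral_add_right_eq_self`, `lintegral_tsum`,
`ENNReal.tsum_mul_left`, `Equiv.tsum_eq`, `tsum_eq_sum`, `Real.smoothTransition`,
`Int.sub_floor_div_mul_nonneg`, `Int.sub_floor_div_mul_lt`.

## References

* Z. Lei, X. Ren, Q. S. Zhang, arXiv:1902.11229, §2 (the domains `D_R`, `P_R`, p. 5; (2.3)–(2.6)),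
  §3 ((3.2)–(3.3)). [LeiRenZhang2019]
-/

noncomputable section

open MeasureTheory Set Function Filter
open scoped ENNReal NNReal Topology

namespace Literature.Analysis.FluidPDE

/-! ### Axial translations -/

/-- Components of an axial translate: `(x + t e_z) 2 = x 2 + t`. [folklore] -/
@[simp] private theorem apply_two_add_smul_eZ (x : (EuclideanSpace ℝ (Fin 3))) (t : ℝ) : (x + t • eZ) 2 = x 2 + t := by
  simp [eZ]

/-- `(x + t e_z) 0 = x 0`. [folklore] -/
@[simp] private theorem apply_zero_add_smul_eZ (x : (EuclideanSpace ℝ (Fin 3))) (t : ℝ) : (x + t • eZ) 0 = x 0 := by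
  simp [eZ]

/-- `(x + t e_z) 1 = x 1`. [folklore] -/
@[simp] private theorem apply_one_add_smul_eZ (x : (EuclideanSpace ℝ (Fin 3))) (t : ℝ) : (x + t • eZ) 1 = x 1 := by
  simp [eZ]

/-- The cylindrical radius does not see axial translations: `r(x + t e_z) = r(x)`. [folklore] -/
private theorem cylRadius_add_smul_eZ' (x : (EuclideanSpace ℝ (Fin 3))) (t : ℝ) : cylRadius (x + t • eZ) = cylRadius x := by
  simp [cylRadius, eZ]

/-- An axially `P`-periodic function is `kP e_z`-periodic for every integer `k`
(`Function.Periodic` form, `e_z = eZ`). [cite: LeiRenZhang2019, §2 (the z-periodic setting: domains D_R = {r<R}×[0,Z₀), P_R, arXiv p. 5)] -/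
theorem IsAxiallyPeriodic.periodic_int_mul_smul_eZ {α : Type*} {P : ℝ} {Q : (EuclideanSpace ℝ (Fin 3)) → α}
    (hQ : IsAxiallyPeriodic P Q) (k : ℤ) : Function.Periodic Q (((k : ℝ) * P) • eZ) := by
  have h : Function.Periodic Q (P • eZ) := hQ
  have h' := h.zsmul k
  intro x
  have e : ((k : ℝ) * P) • (eZ : (EuclideanSpace ℝ (Fin 3))) = k • (P • eZ) := by
    rw [mul_smul, Int.cast_smul_eq_zsmul]
  rw [e]
  exact h' x

/-- A function of `x 0, x 1` and of a periodic quantity is periodic: if `Q` is axially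
`P`-periodic then so is `x ↦ g (r(x)) * Q x` for any `g` (the radial cut-offs of
Lei–Ren–Zhang are independent of `z`). [cite: LeiRenZhang2019, §2 (2.2) (z-independent cut-offs ψ_R on the periodic domain, arXiv p. 5)] -/
theorem IsAxiallyPeriodic.cylRadial_mul {P : ℝ} {Q : (EuclideanSpace ℝ (Fin 3)) → ℝ} (hQ : IsAxiallyPeriodic P Q)
    (g : ℝ → ℝ) : IsAxiallyPeriodic P fun x => g (cylRadius x) * Q x := by
  intro x
  have h1 : cylRadius (x + P • EuclideanSpace.single (2 : Fin 3) (1 : ℝ)) = cylRadius x :=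
    cylRadius_add_smul_eZ' x P
  simp only [h1, hQ x]

/-! ### The period slabs -/

/-- The `k`-th period slab `{x | kP ≤ x 2 < (k + 1)P}`; `zSlab P 0 = {0 ≤ z < P}` is one period
(Lei–Ren–Zhang's `D_R = {r < R} × [0, Z₀)` is `zSlab Z₀ 0 ∩ {r < R}`). [cite: LeiRenZhang2019, §2 (the z-periodic setting: domains D_R = {r<R}×[0,Z₀), P_R, arXiv p. 5)] -/
def zSlab (P : ℝ) (k : ℤ) : Set (EuclideanSpace ℝ (Fin 3)) :=
  {x | x 2 ∈ Ico ((k : ℝ) * P) (((k : ℝ) + 1) * P)}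

/-- Membership in a slab, unfolded. [cite: LeiRenZhang2019, §2 (the z-periodic setting: domains D_R = {r<R}×[0,Z₀), P_R, arXiv p. 5)] -/
theorem mem_zSlab {P : ℝ} {k : ℤ} {x : (EuclideanSpace ℝ (Fin 3))} :
    x ∈ zSlab P k ↔ (k : ℝ) * P ≤ x 2 ∧ x 2 < ((k : ℝ) + 1) * P := Iff.rfl

/-- The coordinate `x ↦ x 2` is measurable. [folklore] -/
private theorem measurable_apply_two : Measurable fun x : (EuclideanSpace ℝ (Fin 3)) => x 2 :=
  (EuclideanSpace.proj (𝕜 := ℝ) (2 : Fin 3)).continuous.measurable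

/-- Slabs are measurable. [cite: LeiRenZhang2019, §2 (the z-periodic setting: domains D_R = {r<R}×[0,Z₀), P_R, arXiv p. 5)] -/
theorem measurableSet_zSlab (P : ℝ) (k : ℤ) : MeasurableSet (zSlab P k) :=
  measurableSet_Ico.preimage measurable_apply_two

/-- Distinct slabs are disjoint (`P > 0`). [cite: LeiRenZhang2019, §2 (the z-periodic setting: domains D_R = {r<R}×[0,Z₀), P_R, arXiv p. 5)] -/
theorem pairwise_disjoint_zSlab {P : ℝ} (hP : 0 < P) : Pairwise (Disjoint on zSlab P) := by
  intro j k hjk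
  rw [Function.onFun, Set.disjoint_left]
  intro x hj hk
  rw [mem_zSlab] at hj hk
  have h1 : (j : ℝ) < (k : ℝ) + 1 := lt_of_mul_lt_mul_right (hj.1.trans_lt hk.2) hP.le
  have h2 : (k : ℝ) < (j : ℝ) + 1 := lt_of_mul_lt_mul_right (hk.1.trans_lt hj.2) hP.le
  have h1' : j < k + 1 := by exact_mod_cast h1
  have h2' : k < j + 1 := by exact_mod_cast h2
  exact hjk (by omega)

/-- Every point lies in the slab of index `⌊x 2 / P⌋` (`P > 0`). [cite: LeiRenZhang2019, §2 (the z-periodic setting: domains D_R = {r<R}×[0,Z₀), P_R, arXiv p. 5)] -/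
theorem mem_zSlab_floor {P : ℝ} (hP : 0 < P) (x : (EuclideanSpace ℝ (Fin 3))) : x ∈ zSlab P ⌊x 2 / P⌋ := by
  rw [mem_zSlab]
  exact ⟨(le_div_iff₀ hP).1 (Int.floor_le _), (div_lt_iff₀ hP).1 (Int.lt_floor_add_one _)⟩

/-- The slabs cover `ℝ³` (`P > 0`). [cite: LeiRenZhang2019, §2 (the z-periodic setting: domains D_R = {r<R}×[0,Z₀), P_R, arXiv p. 5)] -/
theorem iUnion_zSlab {P : ℝ} (hP : 0 < P) : ⋃ k, zSlab P k = univ :=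
  eq_univ_of_forall fun x => mem_iUnion.2 ⟨_, mem_zSlab_floor hP x⟩

/-- Translating by `kP e_z` moves the slab `j` onto the slab `j + k`. [cite: LeiRenZhang2019, §2 (the z-periodic setting: domains D_R = {r<R}×[0,Z₀), P_R, arXiv p. 5)] -/
theorem add_smul_eZ_mem_zSlab_iff {P : ℝ} (j k : ℤ) (x : (EuclideanSpace ℝ (Fin 3))) :
    x + ((k : ℝ) * P) • eZ ∈ zSlab P (j + k) ↔ x ∈ zSlab P j := by
  simp only [mem_zSlab, apply_two_add_smul_eZ, Int.cast_add]
  constructor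
  · rintro ⟨h1, h2⟩; constructor <;> linarith
  · rintro ⟨h1, h2⟩; constructor <;> linarith

/-- **Integrals over a slab are integrals over the fundamental slab of the translate**:
`∫⁻_{zSlab P k} f = ∫⁻_{zSlab P 0} f(· + kP e_z)` (translation invariance of Lebesgue measure).
[cite: LeiRenZhang2019, §2 (2.3)–(2.6) (integration over one period D_R, arXiv pp. 5–6)] -/
theorem setLIntegral_zSlab_eq_zero_slab (P : ℝ) (k : ℤ) (f : (EuclideanSpace ℝ (Fin 3)) → ℝ≥0∞) :
    ∫⁻ x in zSlab P k, f x = ∫⁻ x in zSlab P 0, f (x + ((k : ℝ) * P) • eZ) := by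
  rw [← lintegral_indicator (measurableSet_zSlab P k), ← lintegral_indicator (measurableSet_zSlab P 0),
    ← lintegral_add_right_eq_self (μ := (volume : Measure (EuclideanSpace ℝ (Fin 3))))
      (fun y => (zSlab P k).indicator f y) (((k : ℝ) * P) • eZ)]
  congr 1
  funext y
  have hmem : y + ((k : ℝ) * P) • eZ ∈ zSlab P k ↔ y ∈ zSlab P 0 := by
    have h := add_smul_eZ_mem_zSlab_iff (P := P) 0 k y
    rwa [zero_add] at h
  by_cases hy : y ∈ zSlab P 0
  · rw [indicator_of_mem (hmem.2 hy), indicator_of_mem hy]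
  · rw [indicator_of_notMem (fun h => hy (hmem.1 h)), indicator_of_notMem hy]

/-- For a periodic integrand every slab carries the same integral:
`∫⁻_{zSlab P k} Q = ∫⁻_{zSlab P 0} Q`. [cite: LeiRenZhang2019, §2 (2.3)–(2.6) (integration over one period D_R, arXiv pp. 5–6)] -/
theorem IsAxiallyPeriodic.setLIntegral_zSlab_eq {P : ℝ} {Q : (EuclideanSpace ℝ (Fin 3)) → ℝ≥0∞}
    (hQ : IsAxiallyPeriodic P Q) (k : ℤ) :
    ∫⁻ x in zSlab P k, Q x = ∫⁻ x in zSlab P 0, Q x := by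
  rw [setLIntegral_zSlab_eq_zero_slab]
  exact setLIntegral_congr_fun (measurableSet_zSlab P 0) fun x _ =>
    hQ.periodic_int_mul_smul_eZ k x

/-! ### The period-slab identity -/

/-- **The period-slab identity.** For `Q : ℝ³ → [0, ∞]` a.e.-measurable and axially
`P`-periodic (`P > 0`) and `W : ℝ → [0, ∞]` measurable,
`∫⁻ Q(x) W(x 2) dx = ∫⁻_{zSlab P 0} Q(x) (∑_{k ∈ ℤ} W(x 2 + kP)) dx`: decompose `ℝ³` into the
slabs, translate each slab back to the fundamental one (the integrand becomes
`Q(x) W(x 2 + kP)` by periodicity), and sum under the integral sign. This is the bookkeeping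
behind "integrating over one period `D_R`" in Lei–Ren–Zhang, §2. [cite: LeiRenZhang2019, §2 (the domains D_R, P_R and the integral element dx ds, arXiv p. 5)] -/
theorem lintegral_mul_comp_apply_two_eq {P : ℝ} (hP : 0 < P) {Q : (EuclideanSpace ℝ (Fin 3)) → ℝ≥0∞}
    (hQm : AEMeasurable Q volume) (hQ : IsAxiallyPeriodic P Q) {W : ℝ → ℝ≥0∞}
    (hW : Measurable W) :
    ∫⁻ x, Q x * W (x 2) = ∫⁻ x in zSlab P 0, Q x * ∑' k : ℤ, W (x 2 + (k : ℝ) * P) := by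
  have hWk : ∀ k : ℤ, Measurable fun x : (EuclideanSpace ℝ (Fin 3)) => W (x 2 + (k : ℝ) * P) := fun k =>
    hW.comp (measurable_apply_two.add_const _)
  calc ∫⁻ x, Q x * W (x 2)
      = ∫⁻ x in ⋃ k, zSlab P k, Q x * W (x 2) := by
        rw [iUnion_zSlab hP, Measure.restrict_univ]
    _ = ∑' k, ∫⁻ x in zSlab P k, Q x * W (x 2) :=
        lintegral_iUnion (measurableSet_zSlab P) (pairwise_disjoint_zSlab hP) _
    _ = ∑' k : ℤ, ∫⁻ x in zSlab P 0, Q x * W (x 2 + (k : ℝ) * P) := by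
        refine tsum_congr fun k => ?_
        rw [setLIntegral_zSlab_eq_zero_slab]
        refine setLIntegral_congr_fun (measurableSet_zSlab P 0) fun x _ => ?_
        rw [hQ.periodic_int_mul_smul_eZ k x, apply_two_add_smul_eZ]
    _ = ∫⁻ x in zSlab P 0, ∑' k : ℤ, Q x * W (x 2 + (k : ℝ) * P) := by
        rw [lintegral_tsum]
        intro k
        exact (hQm.restrict.mul (hWk k).aemeasurable)
    _ = ∫⁻ x in zSlab P 0, Q x * ∑' k : ℤ, W (x 2 + (k : ℝ) * P) := by
        refine lintegral_congr fun x => ?_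
        rw [ENNReal.tsum_mul_left]

/-- **Windows whose translates sum to a constant.** If `∑_{k ∈ ℤ} W(z + kP) = c` for every
`z`, then `∫⁻ Q(x) W(x 2) dx = c ∫⁻_{zSlab P 0} Q` for every a.e.-measurable axially
`P`-periodic `Q ≥ 0`. [cite: LeiRenZhang2019, §2 (2.3)–(2.6) (integration over one period D_R, arXiv pp. 5–6)] -/
theorem lintegral_mul_comp_apply_two_eq_const_mul {P : ℝ} (hP : 0 < P) {Q : (EuclideanSpace ℝ (Fin 3)) → ℝ≥0∞}
    (hQm : AEMeasurable Q volume) (hQ : IsAxiallyPeriodic P Q) {W : ℝ → ℝ≥0∞}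
    (hW : Measurable W) {c : ℝ≥0∞} (hc : ∀ z, ∑' k : ℤ, W (z + (k : ℝ) * P) = c) :
    ∫⁻ x, Q x * W (x 2) = c * ∫⁻ x in zSlab P 0, Q x := by
  rw [lintegral_mul_comp_apply_two_eq hP hQm hQ hW]
  simp_rw [hc]
  rw [lintegral_mul_const'' _ hQm.restrict, mul_comm]

/-- The union of the `m` consecutive slabs `a, …, a + m − 1` is the slab
`{aP ≤ x 2 < (a + m)P}` (`P > 0`). [cite: LeiRenZhang2019, §2 (the z-periodic setting: domains D_R = {r<R}×[0,Z₀), P_R, arXiv p. 5)] -/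
theorem iUnion_zSlab_finset_eq {P : ℝ} (hP : 0 < P) (a : ℤ) (m : ℕ) :
    (⋃ k ∈ Finset.Ico a (a + m), zSlab P k) =
      {x : (EuclideanSpace ℝ (Fin 3)) | (a : ℝ) * P ≤ x 2 ∧ x 2 < ((a : ℝ) + m) * P} := by
  ext x
  simp only [mem_iUnion, Finset.mem_Ico, mem_zSlab, mem_setOf_eq, exists_prop]
  constructor
  · rintro ⟨k, ⟨hak, hkm⟩, h1, h2⟩
    have hak' : (a : ℝ) ≤ k := by exact_mod_cast hak
    have hkm' : (k : ℝ) + 1 ≤ (a : ℝ) + m := by exact_mod_cast (show k + 1 ≤ a + m by omega)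
    constructor <;> nlinarith
  · rintro ⟨h1, h2⟩
    refine ⟨⌊x 2 / P⌋, ⟨?_, ?_⟩, (mem_zSlab.1 (mem_zSlab_floor hP x)).1,
      (mem_zSlab.1 (mem_zSlab_floor hP x)).2⟩
    · exact Int.le_floor.2 (by rw [le_div_iff₀ hP]; exact_mod_cast h1)
    · have : x 2 / P < (a : ℝ) + m := by rw [div_lt_iff₀ hP]; exact h2
      have h' : (⌊x 2 / P⌋ : ℝ) < (a : ℝ) + m := (Int.floor_le _).trans_lt this
      exact_mod_cast h'

/-- **`m` periods carry `m` times the integral of one period**: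
`∫⁻_{aP ≤ x 2 < (a+m)P} Q = m ∫⁻_{zSlab P 0} Q` for `Q ≥ 0` axially `P`-periodic (`P > 0`).
[cite: LeiRenZhang2019, §2 (2.3)–(2.6) (integration over one period D_R, arXiv pp. 5–6)] -/
theorem IsAxiallyPeriodic.setLIntegral_slabs_eq_mul {P : ℝ} (hP : 0 < P) {Q : (EuclideanSpace ℝ (Fin 3)) → ℝ≥0∞}
    (hQ : IsAxiallyPeriodic P Q) (a : ℤ) (m : ℕ) :
    ∫⁻ x in {x : (EuclideanSpace ℝ (Fin 3)) | (a : ℝ) * P ≤ x 2 ∧ x 2 < ((a : ℝ) + m) * P}, Q x =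
      m * ∫⁻ x in zSlab P 0, Q x := by
  rw [← iUnion_zSlab_finset_eq hP a m,
    lintegral_biUnion_finset (fun j _ k _ hjk => pairwise_disjoint_zSlab hP hjk)
      (fun k _ => measurableSet_zSlab P k)]
  simp_rw [hQ.setLIntegral_zSlab_eq]
  rw [Finset.sum_const, Int.card_Ico, nsmul_eq_mul]
  congr 1
  simp

/-! ### Bochner versions -/

/-- A periodic function integrable on one slab is integrable on every slab. [cite: LeiRenZhang2019, §2 (2.3)–(2.6) (integration over one period D_R, arXiv pp. 5–6)] -/
theorem IsAxiallyPeriodic.integrableOn_zSlab {P : ℝ} {Q : (EuclideanSpace ℝ (Fin 3)) → ℝ} (hQ : IsAxiallyPeriodic P Q)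
    (hQm : AEStronglyMeasurable Q volume) (hQi : IntegrableOn Q (zSlab P 0)) (k : ℤ) :
    IntegrableOn Q (zSlab P k) := by
  refine ⟨hQm.restrict, ?_⟩
  have hper : IsAxiallyPeriodic P fun x => (‖Q x‖ₑ : ℝ≥0∞) := fun x => by
    simp only [hQ x]
  rw [HasFiniteIntegral, hper.setLIntegral_zSlab_eq k]
  exact hQi.2

/-- A periodic function integrable on one slab is integrable on any finite union of slabs
`{aP ≤ x 2 < (a+m)P}`. [cite: LeiRenZhang2019, §2 (2.3)–(2.6) (integration over one period D_R, arXiv pp. 5–6)] -/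
theorem IsAxiallyPeriodic.integrableOn_slabs {P : ℝ} (hP : 0 < P) {Q : (EuclideanSpace ℝ (Fin 3)) → ℝ}
    (hQ : IsAxiallyPeriodic P Q) (hQm : AEStronglyMeasurable Q volume)
    (hQi : IntegrableOn Q (zSlab P 0)) (a : ℤ) (m : ℕ) :
    IntegrableOn Q {x : (EuclideanSpace ℝ (Fin 3)) | (a : ℝ) * P ≤ x 2 ∧ x 2 < ((a : ℝ) + m) * P} := by
  rw [← iUnion_zSlab_finset_eq hP a m]
  exact (integrableOn_finset_iUnion).2 fun k _ => hQ.integrableOn_zSlab hQm hQi k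

/-- A bounded window supported in `[-A, A]` times a periodic function integrable on one slab
is integrable on `ℝ³` (`P > 0`): the support meets finitely many slabs. [cite: LeiRenZhang2019, §2 (2.3)–(2.6) (integration over one period D_R, arXiv pp. 5–6)] -/
theorem IsAxiallyPeriodic.integrable_mul_comp_apply_two {P : ℝ} (hP : 0 < P) {Q : (EuclideanSpace ℝ (Fin 3)) → ℝ}
    (hQ : IsAxiallyPeriodic P Q) (hQm : AEStronglyMeasurable Q volume)
    (hQi : IntegrableOn Q (zSlab P 0)) {W : ℝ → ℝ} (hWm : Measurable W) {A B : ℝ}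
    (hWA : ∀ z, W z ≠ 0 → z ∈ Icc (-A) A) (hWB : ∀ z, |W z| ≤ B) :
    Integrable (fun x => Q x * W (x 2)) := by
  -- the finite union of slabs containing `{x 2 ∈ [-A, A]}`
  set a : ℤ := ⌊-A / P⌋ with ha
  set m : ℕ := (⌊A / P⌋ - a + 1).toNat with hm
  set U : Set (EuclideanSpace ℝ (Fin 3)) := {x : (EuclideanSpace ℝ (Fin 3)) | (a : ℝ) * P ≤ x 2 ∧ x 2 < ((a : ℝ) + m) * P} with hU
  have hsub : ∀ x : (EuclideanSpace ℝ (Fin 3)), x 2 ∈ Icc (-A) A → x ∈ U := by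
    intro x hx
    have hk := mem_zSlab_floor hP x
    rw [mem_zSlab] at hk
    have h1 : a ≤ ⌊x 2 / P⌋ := Int.floor_le_floor (by
      exact div_le_div_of_nonneg_right hx.1 hP.le)
    have h2 : ⌊x 2 / P⌋ ≤ ⌊A / P⌋ := Int.floor_le_floor (by
      exact div_le_div_of_nonneg_right hx.2 hP.le)
    have hm' : ((m : ℕ) : ℤ) = ⌊A / P⌋ - a + 1 := by
      rw [hm]; exact Int.toNat_of_nonneg (by omega)
    have h1' : (a : ℝ) ≤ ⌊x 2 / P⌋ := by exact_mod_cast h1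
    have h3 : (⌊x 2 / P⌋ : ℝ) + 1 ≤ (a : ℝ) + m := by
      have : ⌊x 2 / P⌋ + 1 ≤ a + (m : ℤ) := by omega
      exact_mod_cast this
    refine ⟨?_, ?_⟩ <;> nlinarith [hk.1, hk.2]
  have hUi : IntegrableOn Q U := hQ.integrableOn_slabs hP hQm hQi a m
  have hUm : MeasurableSet U := by
    rw [hU, ← iUnion_zSlab_finset_eq hP a m]
    exact Finset.measurableSet_biUnion _ fun k _ => measurableSet_zSlab P k
  -- domination by `B ‖Q‖ 1_U`
  have hg : Integrable fun x => U.indicator (fun x => B * ‖Q x‖) x :=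
    IntegrableOn.integrable_indicator (hUi.norm.const_mul B) hUm
  refine hg.mono' (hQm.mul (hWm.comp measurable_apply_two).aestronglyMeasurable)
    (Eventually.of_forall fun x => ?_)
  by_cases hW0 : W (x 2) = 0
  · simp only [hW0, mul_zero, norm_zero]
    by_cases hxU : x ∈ U
    · rw [indicator_of_mem hxU]
      exact mul_nonneg ((abs_nonneg _).trans (hWB 0)) (norm_nonneg _)
    · rw [indicator_of_notMem hxU]
  · rw [indicator_of_mem (hsub x (hWA _ hW0)), norm_mul, mul_comm]
    exact mul_le_mul_of_nonneg_right (by rw [Real.norm_eq_abs]; exact hWB _) (norm_nonneg _)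

/-- Bochner translation for slabs: `∫_{zSlab P k} f = ∫_{zSlab P 0} f(· + kP e_z)`. [cite: LeiRenZhang2019, §2 (2.3)–(2.6) (integration over one period D_R, arXiv pp. 5–6)] -/
theorem setIntegral_zSlab_eq_zero_slab (P : ℝ) (k : ℤ) (f : (EuclideanSpace ℝ (Fin 3)) → ℝ) :
    ∫ x in zSlab P k, f x = ∫ x in zSlab P 0, f (x + ((k : ℝ) * P) • eZ) := by
  rw [← integral_indicator (measurableSet_zSlab P k), ← integral_indicator (measurableSet_zSlab P 0),
    ← integral_add_right_eq_self (μ := (volume : Measure (EuclideanSpace ℝ (Fin 3))))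
      (fun y => (zSlab P k).indicator f y) (((k : ℝ) * P) • eZ)]
  congr 1
  funext y
  have hmem : y + ((k : ℝ) * P) • eZ ∈ zSlab P k ↔ y ∈ zSlab P 0 := by
    have h := add_smul_eZ_mem_zSlab_iff (P := P) 0 k y
    rwa [zero_add] at h
  by_cases hy : y ∈ zSlab P 0
  · rw [indicator_of_mem (hmem.2 hy), indicator_of_mem hy]
  · rw [indicator_of_notMem (fun h => hy (hmem.1 h)), indicator_of_notMem hy]

/-- **Bochner form of the period-slab identity.** For a real axially `P`-periodic `Q`
integrable on one slab and a bounded measurable window `W` supported in `[-A, A]` (`P > 0`),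
`∫ Q(x) W(x 2) dx = ∫_{zSlab P 0} Q(x) (∑_{k ∈ ℤ} W(x 2 + kP)) dx` (for `x 2 ∈ [0, P)` only the
finitely many `k` with `|kP| ≤ A + P` contribute). [cite: LeiRenZhang2019, §2 (2.3)–(2.6) (integration over one period D_R, arXiv pp. 5–6)] -/
theorem IsAxiallyPeriodic.integral_mul_comp_apply_two_eq {P : ℝ} (hP : 0 < P) {Q : (EuclideanSpace ℝ (Fin 3)) → ℝ}
    (hQ : IsAxiallyPeriodic P Q) (hQm : AEStronglyMeasurable Q volume)
    (hQi : IntegrableOn Q (zSlab P 0)) {W : ℝ → ℝ} (hWm : Measurable W) {A B : ℝ}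
    (hWA : ∀ z, W z ≠ 0 → z ∈ Icc (-A) A) (hWB : ∀ z, |W z| ≤ B) :
    ∫ x, Q x * W (x 2) = ∫ x in zSlab P 0, Q x * ∑' k : ℤ, W (x 2 + (k : ℝ) * P) := by
  have hint := hQ.integrable_mul_comp_apply_two hP hQm hQi hWm hWA hWB
  -- the translated terms and their integrability on the fundamental slab
  set g : ℤ → (EuclideanSpace ℝ (Fin 3)) → ℝ := fun k x => Q x * W (x 2 + (k : ℝ) * P) with hg
  have hgi : ∀ k, IntegrableOn (g k) (zSlab P 0) := by
    intro k
    refine Integrable.mono' (hQi.norm.const_mul B) ?_ (Eventually.of_forall fun x => ?_)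
    · exact (hQm.mul (hWm.comp (measurable_apply_two.add_const _)).aestronglyMeasurable).restrict
    · simp only [hg, norm_mul, Real.norm_eq_abs]
      rw [mul_comm]
      exact mul_le_mul_of_nonneg_right (hWB _) (abs_nonneg _)
  -- the terms with `|k|` large vanish on the fundamental slab
  set N : ℤ := ⌈(A + P) / P⌉ with hN
  have hzero : ∀ k : ℤ, k ∉ Finset.Icc (-N) N → ∀ x ∈ zSlab P 0, g k x = 0 := by
    intro k hk x hx
    rw [mem_zSlab, Int.cast_zero, zero_mul, zero_add, one_mul] at hx
    by_contra hne
    have hW : W (x 2 + (k : ℝ) * P) ≠ 0 := fun h => hne (by simp only [hg, h, mul_zero])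
    have hmem := hWA _ hW
    apply hk
    rw [Finset.mem_Icc]
    have hNle : (A + P) / P ≤ (N : ℝ) := Int.le_ceil _
    constructor
    · have h1 : -(A + P) ≤ (k : ℝ) * P := by linarith [hmem.1, hx.2]
      have h2 : -(A + P) / P ≤ (k : ℝ) := (div_le_iff₀ hP).2 h1
      have h3 : -(N : ℝ) ≤ k := by rw [neg_div] at h2; linarith
      exact_mod_cast h3
    · have h1 : (k : ℝ) * P ≤ A + P := by linarith [hmem.2, hx.1]
      have h2 : (k : ℝ) ≤ (A + P) / P := (le_div_iff₀ hP).2 h1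
      have h3 : (k : ℝ) ≤ N := h2.trans hNle
      exact_mod_cast h3
  calc ∫ x, Q x * W (x 2)
      = ∫ x in ⋃ k, zSlab P k, Q x * W (x 2) := by
        rw [iUnion_zSlab hP, Measure.restrict_univ]
    _ = ∑' k, ∫ x in zSlab P k, Q x * W (x 2) :=
        integral_iUnion (measurableSet_zSlab P) (pairwise_disjoint_zSlab hP)
          (by rw [iUnion_zSlab hP]; exact hint.integrableOn)
    _ = ∑' k, ∫ x in zSlab P 0, g k x := by
        refine tsum_congr fun k => ?_
        rw [setIntegral_zSlab_eq_zero_slab]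
        refine setIntegral_congr_fun (measurableSet_zSlab P 0) fun x _ => ?_
        simp only [hg, hQ.periodic_int_mul_smul_eZ k x, apply_two_add_smul_eZ]
    _ = ∫ x in zSlab P 0, ∑' k, g k x := by
        refine integral_tsum_of_summable_integral_norm hgi ?_
        refine summable_of_hasFiniteSupport
          ((Finset.Icc (-N) N).finite_toSet.subset fun k hk => ?_)
        by_contra hkN
        apply hk
        show ∫ x in zSlab P 0, ‖g k x‖ = 0
        refine setIntegral_eq_zero_of_forall_eq_zero fun x hx => ?_
        rw [hzero k hkN x hx, norm_zero]
    _ = ∫ x in zSlab P 0, Q x * ∑' k : ℤ, W (x 2 + (k : ℝ) * P) := by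
        refine setIntegral_congr_fun (measurableSet_zSlab P 0) fun x _ => ?_
        simp only [hg]
        exact tsum_mul_left

/-- **Windows whose translates sum to a constant (Bochner form).** If the bounded measurable
window `W` supported in `[-A, A]` has `∑_{k ∈ ℤ} W(z + kP) = c` for every `z`, then
`∫ Q(x) W(x 2) dx = c ∫_{zSlab P 0} Q` for every real axially `P`-periodic `Q` integrable on
one slab (`P > 0`). [cite: LeiRenZhang2019, §2 (2.3)–(2.6) (integration over one period D_R, arXiv pp. 5–6)] -/
theorem IsAxiallyPeriodic.integral_mul_comp_apply_two_eq_const_mul {P : ℝ} (hP : 0 < P)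
    {Q : (EuclideanSpace ℝ (Fin 3)) → ℝ} (hQ : IsAxiallyPeriodic P Q) (hQm : AEStronglyMeasurable Q volume)
    (hQi : IntegrableOn Q (zSlab P 0)) {W : ℝ → ℝ} (hWm : Measurable W)
    {A B : ℝ} (hWA : ∀ z, W z ≠ 0 → z ∈ Icc (-A) A) (hWB : ∀ z, |W z| ≤ B) {c : ℝ}
    (hc : ∀ z, ∑' k : ℤ, W (z + (k : ℝ) * P) = c) :
    ∫ x, Q x * W (x 2) = c * ∫ x in zSlab P 0, Q x := by
  rw [hQ.integral_mul_comp_apply_two_eq hP hQm hQi hWm hWA hWB]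
  simp_rw [hc]
  rw [integral_mul_const, mul_comm]

/-- The topological support of a compactly supported function on `ℝ` lies in some `[-A, A]`.
[folklore] -/
private theorem exists_tsupport_subset_Icc {W : ℝ → ℝ} (hWc : HasCompactSupport W) :
    ∃ A : ℝ, tsupport W ⊆ Icc (-A) A := by
  obtain ⟨A, hA⟩ := hWc.isCompact.isBounded.subset_closedBall 0
  refine ⟨A, fun z hz => ?_⟩
  have h := hA hz
  rw [Metric.mem_closedBall, dist_zero_right, Real.norm_eq_abs, abs_le] at h
  exact h

/-- **The translates of the derivative of a constant-sum window sum to zero.** If `W ∈ C¹`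
has compact support and `∑_{k ∈ ℤ} W(z + kP) = c` for all `z` (`P > 0`), then
`∑_{k ∈ ℤ} W'(z + kP) = 0` for all `z`: locally the series is a finite sum, which may be
differentiated term by term. [folklore] -/
private theorem tsum_deriv_comp_add_int_mul_eq_zero {P : ℝ} (hP : 0 < P) {W : ℝ → ℝ}
    (hW : ContDiff ℝ 1 W) (hWc : HasCompactSupport W) {c : ℝ}
    (hc : ∀ z, ∑' k : ℤ, W (z + (k : ℝ) * P) = c) (z₀ : ℝ) :
    ∑' k : ℤ, deriv W (z₀ + (k : ℝ) * P) = 0 := by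
  obtain ⟨A, hA⟩ := exists_tsupport_subset_Icc hWc
  -- the finite set of live indices near `z₀`
  set N : ℤ := ⌈(A + |z₀| + 1) / P⌉ with hN
  set K : Finset ℤ := Finset.Icc (-N) N with hK
  have hout : ∀ z ∈ Ioo (z₀ - 1) (z₀ + 1), ∀ k : ℤ, k ∉ K →
      z + (k : ℝ) * P ∉ tsupport W := by
    intro z hz k hk hmem
    have h := hA hmem
    apply hk
    rw [hK, Finset.mem_Icc]
    have hNle : (A + |z₀| + 1) / P ≤ (N : ℝ) := Int.le_ceil _
    have hza : z ≤ |z₀| + 1 := by linarith [hz.2, le_abs_self z₀]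
    have hzb : -(|z₀| + 1) ≤ z := by linarith [hz.1, neg_abs_le z₀]
    constructor
    · have h1 : -(A + |z₀| + 1) ≤ (k : ℝ) * P := by linarith [h.1]
      have h2 : -(A + |z₀| + 1) / P ≤ (k : ℝ) := (div_le_iff₀ hP).2 h1
      have h3 : -(N : ℝ) ≤ k := by rw [neg_div] at h2; linarith
      exact_mod_cast h3
    · have h1 : (k : ℝ) * P ≤ A + |z₀| + 1 := by linarith [h.2]
      have h2 : (k : ℝ) ≤ (A + |z₀| + 1) / P := (le_div_iff₀ hP).2 h1
      have h3 : (k : ℝ) ≤ N := h2.trans hNle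
      exact_mod_cast h3
  have hz₀ : z₀ ∈ Ioo (z₀ - 1) (z₀ + 1) := ⟨by linarith, by linarith⟩
  -- near `z₀` the series is the finite sum over `K`
  have hloc : ∀ z ∈ Ioo (z₀ - 1) (z₀ + 1),
      ∑' k : ℤ, W (z + (k : ℝ) * P) = ∑ k ∈ K, W (z + (k : ℝ) * P) := fun z hz =>
    tsum_eq_sum fun k hk => image_eq_zero_of_notMem_tsupport (hout z hz k hk)
  have hloc' : ∑' k : ℤ, deriv W (z₀ + (k : ℝ) * P) = ∑ k ∈ K, deriv W (z₀ + (k : ℝ) * P) :=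
    tsum_eq_sum fun k hk => by
      have h : z₀ + (k : ℝ) * P ∉ tsupport W := hout z₀ hz₀ k hk
      by_contra hne
      exact h (support_deriv_subset (mem_support.2 hne))
  rw [hloc']
  have hWd : ∀ y, DifferentiableAt ℝ W y := fun y => (hW.differentiable one_ne_zero) y
  have hsum : deriv (fun z => ∑ k ∈ K, W (z + (k : ℝ) * P)) z₀ =
      ∑ k ∈ K, deriv W (z₀ + (k : ℝ) * P) := by
    have hd : ∀ k ∈ K, DifferentiableAt ℝ (fun z => W (z + (k : ℝ) * P)) z₀ := fun k _ =>
      (hWd _).comp z₀ (differentiableAt_id.add_const _)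
    rw [deriv_fun_sum hd]
    refine Finset.sum_congr rfl fun k _ => ?_
    exact deriv_comp_add_const W ((k : ℝ) * P) z₀
  have hconst : deriv (fun z => ∑ k ∈ K, W (z + (k : ℝ) * P)) z₀ = 0 := by
    have heq : (fun z => ∑ k ∈ K, W (z + (k : ℝ) * P)) =ᶠ[𝓝 z₀] fun _ => c := by
      filter_upwards [Ioo_mem_nhds hz₀.1 hz₀.2] with z hz
      rw [← hloc z hz, hc z]
    rw [heq.deriv_eq, deriv_const]
  rw [← hsum, hconst]

/-- **The derivative of a constant-sum window integrates periodic functions to zero**: for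
`W ∈ C¹` with compact support and `∑_{k ∈ ℤ} W(z + kP) = c`, and `Q` real, axially
`P`-periodic and integrable on one slab (`P > 0`), `∫ Q(x) W'(x 2) dx = 0`. This is why the
terms in which a derivative falls on the axial window drop out of the energy identities per
period (Lei–Ren–Zhang integrate by parts in `z` "using periodicity", (2.3)–(2.4), (3.2)). [cite: LeiRenZhang2019, §2 (2.3)–(2.4) and §3 (3.2) (no boundary terms in z by periodicity)] -/
theorem IsAxiallyPeriodic.integral_mul_deriv_comp_apply_two_eq_zero {P : ℝ} (hP : 0 < P)
    {Q : (EuclideanSpace ℝ (Fin 3)) → ℝ} (hQ : IsAxiallyPeriodic P Q) (hQm : AEStronglyMeasurable Q volume)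
    (hQi : IntegrableOn Q (zSlab P 0)) {W : ℝ → ℝ} (hW : ContDiff ℝ 1 W)
    (hWc : HasCompactSupport W) {c : ℝ} (hc : ∀ z, ∑' k : ℤ, W (z + (k : ℝ) * P) = c) :
    ∫ x, Q x * deriv W (x 2) = 0 := by
  obtain ⟨A, hA⟩ := exists_tsupport_subset_Icc hWc
  have hdc : Continuous (deriv W) := hW.continuous_deriv le_rfl
  obtain ⟨B, hB⟩ := hWc.deriv.exists_bound_of_continuous hdc
  have h := hQ.integral_mul_comp_apply_two_eq_const_mul hP hQm hQi hdc.measurable (A := A) (B := B)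
    (fun z hz => hA (support_deriv_subset (mem_support.2 hz)))
    (fun z => by have := hB z; rwa [Real.norm_eq_abs] at this)
    (tsum_deriv_comp_add_int_mul_eq_zero hP hW hWc hc)
  rw [h, zero_mul]

/-! ### The smooth partition-of-unity window -/

/-- The angle profile `θ(v) = (π/2) · smoothTransition(v)`: smooth, `0` for `v ≤ 0`, `π/2` for
`v ≥ 1`, with values in `[0, π/2]`. [folklore] -/
def windowAngle (v : ℝ) : ℝ := Real.pi / 2 * Real.smoothTransition v

/-- `θ(v) = 0` for `v ≤ 0`. [folklore] -/
private theorem windowAngle_of_nonpos {v : ℝ} (hv : v ≤ 0) : windowAngle v = 0 := by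
  simp [windowAngle, Real.smoothTransition.zero_of_nonpos hv]

/-- `θ(v) = π/2` for `v ≥ 1`. [folklore] -/
private theorem windowAngle_of_one_le {v : ℝ} (hv : 1 ≤ v) : windowAngle v = Real.pi / 2 := by
  simp [windowAngle, Real.smoothTransition.one_of_one_le hv]

/-- `0 ≤ θ`. [folklore] -/
private theorem windowAngle_nonneg (v : ℝ) : 0 ≤ windowAngle v :=
  mul_nonneg (by positivity) (Real.smoothTransition.nonneg v)

/-- `θ ≤ π/2`. [folklore] -/
private theorem windowAngle_le (v : ℝ) : windowAngle v ≤ Real.pi / 2 :=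
  mul_le_of_le_one_right (by positivity) (Real.smoothTransition.le_one v)

/-- `θ` is smooth. [folklore] -/
private theorem contDiff_windowAngle {n : ℕ∞} : ContDiff ℝ n windowAngle :=
  contDiff_const.mul Real.smoothTransition.contDiff

/-- **The periodic partition-of-unity window** `ω_P(z) = sin θ(z/P) · cos θ(z/P − 1)`: smooth,
supported in `[0, 2P]`, values in `[0, 1]`, and `∑_{k ∈ ℤ} ω_P(z + kP)² = 1`. It renders
Lei–Ren–Zhang's "cut-off functions [that] together with the periodicity of solutions" restrict all
integrals to one period (their `ψ_R` is independent of `z`): `∫ Q ω_P(z)² dx` is the integral of a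
periodic `Q` over one period, for a compactly supported smooth weight. [cite: LeiRenZhang2019, §2 (2.2) (z-independent cut-offs ψ_R on the periodic domain, arXiv p. 5)] -/
def periodicWindow (P z : ℝ) : ℝ :=
  Real.sin (windowAngle (z / P)) * Real.cos (windowAngle (z / P - 1))

/-- The window is smooth. [cite: LeiRenZhang2019, §2 (2.2) (z-independent cut-offs ψ_R on the periodic domain, arXiv p. 5)] -/
theorem contDiff_periodicWindow (P : ℝ) {n : ℕ∞} : ContDiff ℝ n (periodicWindow P) := by
  have h1 : ContDiff ℝ (n : WithTop ℕ∞) fun z : ℝ => z / P := contDiff_id.div_const P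
  unfold periodicWindow
  exact (Real.contDiff_sin.comp (contDiff_windowAngle.comp h1)).mul
    (Real.contDiff_cos.comp (contDiff_windowAngle.comp (h1.sub contDiff_const)))

/-- `0 ≤ ω_P`. [cite: LeiRenZhang2019, §2 (2.2) (z-independent cut-offs ψ_R on the periodic domain, arXiv p. 5)] -/
theorem periodicWindow_nonneg (P z : ℝ) : 0 ≤ periodicWindow P z := by
  unfold periodicWindow
  refine mul_nonneg (Real.sin_nonneg_of_nonneg_of_le_pi (windowAngle_nonneg _)
    ((windowAngle_le _).trans (by linarith [Real.pi_pos]))) ?_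
  exact Real.cos_nonneg_of_neg_pi_div_two_le_of_le
    (by linarith [Real.pi_pos, windowAngle_nonneg (z / P - 1)]) (windowAngle_le _)

/-- `ω_P ≤ 1`. [cite: LeiRenZhang2019, §2 (2.2) (z-independent cut-offs ψ_R on the periodic domain, arXiv p. 5)] -/
theorem periodicWindow_le_one (P z : ℝ) : periodicWindow P z ≤ 1 := by
  unfold periodicWindow
  have hc : 0 ≤ Real.cos (windowAngle (z / P - 1)) :=
    Real.cos_nonneg_of_neg_pi_div_two_le_of_le
      (by linarith [Real.pi_pos, windowAngle_nonneg (z / P - 1)]) (windowAngle_le _)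
  exact mul_le_one₀ (Real.sin_le_one _) hc (Real.cos_le_one _)

/-- `|ω_P| ≤ 1`. [cite: LeiRenZhang2019, §2 (2.2) (z-independent cut-offs ψ_R on the periodic domain, arXiv p. 5)] -/
theorem abs_periodicWindow_le_one (P z : ℝ) : |periodicWindow P z| ≤ 1 := by
  rw [abs_of_nonneg (periodicWindow_nonneg P z)]
  exact periodicWindow_le_one P z

/-- `ω_P(z) = 0` for `z ≤ 0` (`P > 0`). [cite: LeiRenZhang2019, §2 (2.2) (z-independent cut-offs ψ_R on the periodic domain, arXiv p. 5)] -/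
theorem periodicWindow_eq_zero_of_nonpos {P : ℝ} (hP : 0 < P) {z : ℝ} (hz : z ≤ 0) :
    periodicWindow P z = 0 := by
  have : z / P ≤ 0 := div_nonpos_of_nonpos_of_nonneg hz hP.le
  simp [periodicWindow, windowAngle_of_nonpos this]

/-- `ω_P(z) = 0` for `z ≥ 2P` (`P > 0`). [cite: LeiRenZhang2019, §2 (2.2) (z-independent cut-offs ψ_R on the periodic domain, arXiv p. 5)] -/
theorem periodicWindow_eq_zero_of_two_mul_le {P : ℝ} (hP : 0 < P) {z : ℝ} (hz : 2 * P ≤ z) :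
    periodicWindow P z = 0 := by
  have : 1 ≤ z / P - 1 := by
    rw [le_sub_iff_add_le, le_div_iff₀ hP]; linarith
  simp [periodicWindow, windowAngle_of_one_le this, Real.cos_pi_div_two]

/-- A point where `ω_P ≠ 0` lies in `(0, 2P)` (`P > 0`). [cite: LeiRenZhang2019, §2 (2.2) (z-independent cut-offs ψ_R on the periodic domain, arXiv p. 5)] -/
theorem mem_Ioo_of_periodicWindow_ne_zero {P : ℝ} (hP : 0 < P) {z : ℝ}
    (hz : periodicWindow P z ≠ 0) : z ∈ Ioo 0 (2 * P) := by
  by_contra h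
  rw [mem_Ioo, not_and_or, not_lt, not_lt] at h
  rcases h with h | h
  · exact hz (periodicWindow_eq_zero_of_nonpos hP h)
  · exact hz (periodicWindow_eq_zero_of_two_mul_le hP h)

/-- The topological support of `ω_P` lies in `[0, 2P]` (`P > 0`). [cite: LeiRenZhang2019, §2 (2.2) (z-independent cut-offs ψ_R on the periodic domain, arXiv p. 5)] -/
theorem tsupport_periodicWindow_subset {P : ℝ} (hP : 0 < P) :
    tsupport (periodicWindow P) ⊆ Icc 0 (2 * P) :=
  closure_minimal (fun _ hz => Ioo_subset_Icc_self (mem_Ioo_of_periodicWindow_ne_zero hP hz))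
    isClosed_Icc

/-- `ω_P` has compact support (`P > 0`). [cite: LeiRenZhang2019, §2 (2.2) (z-independent cut-offs ψ_R on the periodic domain, arXiv p. 5)] -/
theorem hasCompactSupport_periodicWindow {P : ℝ} (hP : 0 < P) :
    HasCompactSupport (periodicWindow P) :=
  isCompact_Icc.of_isClosed_subset (isClosed_tsupport _) (tsupport_periodicWindow_subset hP)

/-- On the fundamental period the two live translates are `sin θ` and `cos θ` of the same
argument: `ω_P(z)² + ω_P(z + P)² = 1` for `z ∈ [0, P)`. [folklore] -/
private theorem periodicWindow_sq_add_sq {P : ℝ} (hP : 0 < P) {z : ℝ} (hz : z ∈ Ico 0 P) :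
    periodicWindow P z ^ 2 + periodicWindow P (z + P) ^ 2 = 1 := by
  have h1 : z / P - 1 ≤ 0 := by
    rw [sub_nonpos, div_le_one hP]; exact hz.2.le
  have h2 : 1 ≤ (z + P) / P := by
    rw [le_div_iff₀ hP]; linarith [hz.1]
  have h3 : (z + P) / P - 1 = z / P := by
    field_simp
    ring
  simp only [periodicWindow, windowAngle_of_nonpos h1, Real.cos_zero, mul_one,
    windowAngle_of_one_le h2, Real.sin_pi_div_two, one_mul, h3]
  exact Real.sin_sq_add_cos_sq _

/-- The other translates vanish on the fundamental period: for `z ∈ [0, P)` and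
`k ∉ {0, 1}`, `ω_P(z + kP) = 0`. [folklore] -/
private theorem periodicWindow_add_int_mul_eq_zero {P : ℝ} (hP : 0 < P) {z : ℝ} (hz : z ∈ Ico 0 P)
    {k : ℤ} (hk0 : k ≠ 0) (hk1 : k ≠ 1) : periodicWindow P (z + (k : ℝ) * P) = 0 := by
  rcases lt_or_gt_of_ne hk0 with hk | hk
  · apply periodicWindow_eq_zero_of_nonpos hP
    have : (k : ℝ) ≤ -1 := by exact_mod_cast (show k ≤ -1 by omega)
    nlinarith [hz.2, hz.1]
  · apply periodicWindow_eq_zero_of_two_mul_le hP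
    have : (2 : ℝ) ≤ k := by exact_mod_cast (show (2 : ℤ) ≤ k by omega)
    nlinarith [hz.1]

/-- **Partition of unity**: `∑_{k ∈ ℤ} ω_P(z + kP)² = 1` for every real `z` (`P > 0`).
[cite: LeiRenZhang2019, §2 (2.2) (z-independent cut-offs ψ_R on the periodic domain, arXiv p. 5)] -/
theorem tsum_periodicWindow_sq {P : ℝ} (hP : 0 < P) (z : ℝ) :
    ∑' k : ℤ, periodicWindow P (z + (k : ℝ) * P) ^ 2 = 1 := by
  -- reduce `z` into the fundamental period
  set m : ℤ := ⌊z / P⌋ with hm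
  set z₀ : ℝ := z - (m : ℝ) * P with hz₀
  have hz₀m : z₀ ∈ Ico 0 P := ⟨Int.sub_floor_div_mul_nonneg z hP, Int.sub_floor_div_mul_lt z hP⟩
  set g : ℤ → ℝ := fun j => periodicWindow P (z₀ + (j : ℝ) * P) ^ 2 with hg
  have hre : (fun k : ℤ => periodicWindow P (z + (k : ℝ) * P) ^ 2) =
      fun k => g (Equiv.addRight m k) := by
    funext k
    simp only [hg, hz₀, Equiv.coe_addRight, Int.cast_add]
    ring_nf
  rw [hre, Equiv.tsum_eq (Equiv.addRight m) g]
  rw [tsum_eq_sum (s := ({0, 1} : Finset ℤ))]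
  · rw [Finset.sum_pair (by norm_num)]
    simp only [hg, Int.cast_zero, zero_mul, add_zero, Int.cast_one, one_mul]
    exact periodicWindow_sq_add_sq hP hz₀m
  · intro k hk
    simp only [Finset.mem_insert, Finset.mem_singleton, not_or] at hk
    simp only [hg, periodicWindow_add_int_mul_eq_zero hP hz₀m hk.1 hk.2]
    ring

/-- The squared window is measurable (it is continuous). [cite: LeiRenZhang2019, §2 (2.2) (z-independent cut-offs ψ_R on the periodic domain, arXiv p. 5)] -/
theorem measurable_periodicWindow_sq (P : ℝ) : Measurable fun z => periodicWindow P z ^ 2 :=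
  ((contDiff_periodicWindow P (n := 0)).continuous.pow 2).measurable

/-- **A whole-space integral against `ω_P(z)²` is the integral over one period** (`ℝ≥0∞`
version): `∫⁻ Q(x) ω_P(x 2)² dx = ∫⁻_{zSlab P 0} Q` for `Q ≥ 0` a.e.-measurable and axially
`P`-periodic (`P > 0`). [cite: LeiRenZhang2019, §2 (2.3)–(2.6) (integration over one period D_R, arXiv pp. 5–6)] -/
theorem lintegral_mul_periodicWindow_sq {P : ℝ} (hP : 0 < P) {Q : (EuclideanSpace ℝ (Fin 3)) → ℝ≥0∞}
    (hQm : AEMeasurable Q volume) (hQ : IsAxiallyPeriodic P Q) :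
    ∫⁻ x, Q x * ENNReal.ofReal (periodicWindow P (x 2) ^ 2) = ∫⁻ x in zSlab P 0, Q x := by
  have h := lintegral_mul_comp_apply_two_eq_const_mul hP hQm hQ
    (W := fun z => ENNReal.ofReal (periodicWindow P z ^ 2))
    (ENNReal.measurable_ofReal.comp (measurable_periodicWindow_sq P)) (c := 1) (fun z => by
      have hs : Summable fun k : ℤ => periodicWindow P (z + (k : ℝ) * P) ^ 2 := by
        by_contra hns
        have := tsum_eq_zero_of_not_summable hns
        rw [tsum_periodicWindow_sq hP z] at this
        exact one_ne_zero this
      rw [← ENNReal.ofReal_tsum_of_nonneg (fun k => sq_nonneg _) hs, tsum_periodicWindow_sq hP z,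
        ENNReal.ofReal_one])
  rw [h, one_mul]

/-- **A whole-space integral against `ω_P(z)²` is the integral over one period** (Bochner
version): `∫ Q(x) ω_P(x 2)² dx = ∫_{zSlab P 0} Q` for real axially `P`-periodic `Q`
integrable on one slab (`P > 0`). This is how integrals "over `D_R`" of periodic densities are
represented by whole-space integrals against a smooth compactly supported weight. [cite: LeiRenZhang2019, §2 (integrals over one period D_R, arXiv p. 5)] -/
theorem integral_mul_periodicWindow_sq {P : ℝ} (hP : 0 < P) {Q : (EuclideanSpace ℝ (Fin 3)) → ℝ}
    (hQ : IsAxiallyPeriodic P Q) (hQm : AEStronglyMeasurable Q volume)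
    (hQi : IntegrableOn Q (zSlab P 0)) :
    ∫ x, Q x * periodicWindow P (x 2) ^ 2 = ∫ x in zSlab P 0, Q x := by
  have h := hQ.integral_mul_comp_apply_two_eq_const_mul hP hQm hQi (measurable_periodicWindow_sq P)
    (A := 2 * P) (B := 1)
    (fun z hz => by
      have hz' : periodicWindow P z ≠ 0 := fun h => hz (by rw [h]; ring)
      have hm := mem_Ioo_of_periodicWindow_ne_zero hP hz'
      exact ⟨by linarith [hm.1], hm.2.le⟩)
    (fun z => by
      rw [abs_of_nonneg (sq_nonneg _), sq_le_one_iff_abs_le_one]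
      exact abs_periodicWindow_le_one P z)
    (tsum_periodicWindow_sq hP)
  rw [h, one_mul]

/-- The window times a periodic function integrable on one slab is integrable on `ℝ³`.
[cite: LeiRenZhang2019, §2 (2.3)–(2.6) (integration over one period D_R, arXiv pp. 5–6)] -/
theorem integrable_mul_periodicWindow_sq {P : ℝ} (hP : 0 < P) {Q : (EuclideanSpace ℝ (Fin 3)) → ℝ}
    (hQ : IsAxiallyPeriodic P Q) (hQm : AEStronglyMeasurable Q volume)
    (hQi : IntegrableOn Q (zSlab P 0)) :
    Integrable (fun x => Q x * periodicWindow P (x 2) ^ 2) :=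
  hQ.integrable_mul_comp_apply_two hP hQm hQi (measurable_periodicWindow_sq P) (A := 2 * P) (B := 1)
    (fun z hz => by
      have hz' : periodicWindow P z ≠ 0 := fun h => hz (by rw [h]; ring)
      have hm := mem_Ioo_of_periodicWindow_ne_zero hP hz'
      exact ⟨by linarith [hm.1], hm.2.le⟩)
    (fun z => by
      rw [abs_of_nonneg (sq_nonneg _), sq_le_one_iff_abs_le_one]
      exact abs_periodicWindow_le_one P z)

/-- `ω_P²` is `C¹` (indeed smooth). [cite: LeiRenZhang2019, §2 (2.2) (z-independent cut-offs ψ_R on the periodic domain, arXiv p. 5)] -/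
theorem contDiff_periodicWindow_sq (P : ℝ) {n : ℕ∞} :
    ContDiff ℝ n fun z => periodicWindow P z ^ 2 :=
  (contDiff_periodicWindow P).pow 2

/-- `ω_P²` has compact support (`P > 0`). [cite: LeiRenZhang2019, §2 (2.2) (z-independent cut-offs ψ_R on the periodic domain, arXiv p. 5)] -/
theorem hasCompactSupport_periodicWindow_sq {P : ℝ} (hP : 0 < P) :
    HasCompactSupport fun z => periodicWindow P z ^ 2 := by
  have h := (hasCompactSupport_periodicWindow hP).mul_left (f := periodicWindow P)
  refine h.mono fun z hz => ?_
  simpa [sq] using hz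

/-- **The axial window's derivative terms vanish**: `∫ Q(x) (ω_P²)'(x 2) dx = 0` for every real
axially `P`-periodic `Q` integrable on one slab (`P > 0`). [cite: LeiRenZhang2019, §2 (2.3)–(2.4) (no boundary terms in z by periodicity)] -/
theorem integral_mul_deriv_periodicWindow_sq_eq_zero {P : ℝ} (hP : 0 < P) {Q : (EuclideanSpace ℝ (Fin 3)) → ℝ}
    (hQ : IsAxiallyPeriodic P Q) (hQm : AEStronglyMeasurable Q volume)
    (hQi : IntegrableOn Q (zSlab P 0)) :
    ∫ x, Q x * deriv (fun z => periodicWindow P z ^ 2) (x 2) = 0 :=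
  hQ.integral_mul_deriv_comp_apply_two_eq_zero hP hQm hQi (contDiff_periodicWindow_sq P (n := 1))
    (hasCompactSupport_periodicWindow_sq hP) (tsum_periodicWindow_sq hP)

end Literature.Analysis.FluidPDE

end
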